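import Literature.NumberTheory.Automorphic.SiegelSetVolume
import Literature.NumberTheory.Automorphic.MinkowskiReductionGLn
import Literature.NumberTheory.Automorphic.GLnAdelicIntegrationFactsProofs
import Literature.MeasureTheory.Group.DiscreteFundamentalDomain
import HarnessLib

/-!
# The norm band of `GL_n(𝔸_K)` and its covering by rational translates of an inverted Siegel set

Penultimate layer of the proof of the Borel–Harish-Chandra finiteness theorem for `GL_n`
(`AdelicGroupData.exists_isAutomorphicMeasure_gl`). The automorphic quotient divides by
`A_G = ℝ_{>0}` as well as by `GL_n(K)`; instead of passing to `GL_n(𝔸_K)¹` we work in the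
**norm band** `D = {1/2 ≤ |det|_𝔸 ≤ 2}` of `GL_n(𝔸_K)`:

* `glAbsDet : GL_n(𝔸_K) →* ℝ_{>0}`, `|det g|_𝔸`; `= 1` on `GL_n(K)` (product formula,
  `ideleNorm_det_toAdelic`) and on the Siegel cone, `= r^{n[K:ℚ]}` on `z(r)`; every value is attained
  on `A_G` (`exists_glAbsDet_posRealScalar_eq`);
* `normBand` — closed, right `GL_n(K)`-invariant, and `g • D = z • D` whenever `|det z| = |det g|`;
* `normBand_subset_iUnion_smul` — by reduction theory (`reductionTheory_gl_holds`:
  `GL_n(K) A_G S = GL_n(𝔸_K)`), `D ⊆ ⋃_{γ ∈ GL_n(K)} (Z · Ω̄ · A_{T₀}(t) · K)⁻¹ γ` for a compact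
  `Z ⊆ A_G` — a set of finite Haar measure by `measure_mul_siegelSet_lt_top` and unimodularity.

Everything is proved.

## References

* A. Borel, Publ. Math. IHÉS 16 (1963), §5, Thm. 5.8 [Borel1963]; J. R. Getz, H. Hahn (2024),
  §2.6, Thm. 2.6.2 [GetzHahn2024].
-/

noncomputable section

open MeasureTheory Measure NumberField IsDedekindDomain Matrix Set
open scoped MatrixGroups NNReal ENNReal Pointwise

namespace Literature.NumberTheory.Automorphic

section Norm

variable (n : ℕ) (K : Type) [Field K] [NumberField K]

local notation "𝔸" => AdeleRing (𝓞 K) K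

/-- **The adelic absolute value of the determinant** `g ↦ |det g|_𝔸` on `GL_n(𝔸_K)`, as a
homomorphism to the positive reals `ℝ≥0ˣ` (`ideleNormUnits ∘ det`). [folklore] -/
def glAbsDet : GL (Fin n) 𝔸 →* ℝ≥0ˣ :=
  (ideleNormUnits K).comp
    (Matrix.GeneralLinearGroup.det : GL (Fin n) 𝔸 →* (AdeleRing (𝓞 K) K)ˣ)

/-- `|det g|_𝔸` is continuous. [folklore] -/
theorem continuous_glAbsDet : Continuous (glAbsDet n K) :=
  (continuous_ideleNormUnits K).comp Matrix.GeneralLinearGroup.continuous_det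

/-- `g ↦ |det g|_𝔸 ∈ ℝ` is continuous. [folklore] -/
theorem continuous_glAbsDet_real :
    Continuous fun g : GL (Fin n) 𝔸 => ((glAbsDet n K g : ℝ≥0) : ℝ) :=
  NNReal.continuous_coe.comp (Units.continuous_val.comp (continuous_glAbsDet n K))

variable {n K} in
/-- **Product formula**: `|det γ|_𝔸 = 1` for rational `γ` (`ideleNorm_det_toAdelic`). [folklore] -/
theorem glAbsDet_eq_one_of_mem_rationalPointsGL {γ : GL (Fin n) 𝔸} (hγ : γ ∈ rationalPointsGL n K) :
    glAbsDet n K γ = 1 := by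
  obtain ⟨g, rfl⟩ := hγ
  exact Units.ext (ideleNorm_det_toAdelic n K g)

/-- `|det z(r)|_𝔸 = r^{n [K:ℚ]}` for the positive real scalar `z(r)`. [folklore] -/
theorem glAbsDet_posRealScalar (r : ℝ≥0ˣ) :
    glAbsDet n K (posRealScalar n K r) = r ^ (n * Module.finrank ℚ K) :=
  ideleNormUnits_det_posRealScalar n K r

variable {n K} in
/-- `|det a|_𝔸 = 1` on the Siegel cone `A_{T₀}(t)`: the determinant of `diag(z(b₁), …, z(bₙ))` is
`z(∏ bᵢ) = z(1) = 1`. [folklore] -/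
theorem glAbsDet_eq_one_of_mem_siegelCone {t : ℝ} {a : GL (Fin n) 𝔸} (ha : a ∈ siegelCone n K t) :
    glAbsDet n K a = 1 := by
  obtain ⟨b, hprod, -, rfl⟩ := ha
  have hb : ∏ i, b i = 1 := by
    refine Units.ext (NNReal.eq ?_)
    rw [Units.coe_prod, NNReal.coe_prod, Units.val_one, NNReal.coe_one]
    exact hprod
  have hdet : Matrix.GeneralLinearGroup.det (posRealDiagonal n K b) = posRealIdele K (∏ i, b i) := by
    refine Units.ext ?_
    rw [Matrix.GeneralLinearGroup.val_det_apply, coe_posRealDiagonal, Matrix.det_diagonal, map_prod,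
      Units.coe_prod]
  change ideleNormUnits K (Matrix.GeneralLinearGroup.det (posRealDiagonal n K b)) = 1
  rw [hdet, hb, map_one, map_one]

/-- **Every value of `|det|_𝔸` is attained on `A_G`**: for every `g` there is a positive real
scalar `z(r)` with `|det z(r)|_𝔸 = |det g|_𝔸` (for `n ≥ 1` take `r = |det g|^{1/(n[K:ℚ])}`; for
`n = 0` both sides are `1`). [folklore] -/
theorem exists_glAbsDet_posRealScalar_eq (g : GL (Fin n) 𝔸) :
    ∃ r : ℝ≥0ˣ, glAbsDet n K (posRealScalar n K r) = glAbsDet n K g := by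
  rcases Nat.eq_zero_or_pos n with hn | hn
  · subst hn
    refine ⟨1, ?_⟩
    rw [Subsingleton.elim g 1, map_one, map_one]
  · set N : ℕ := n * Module.finrank ℚ K with hN
    have hN0 : N ≠ 0 := Nat.mul_ne_zero hn.ne' Module.finrank_pos.ne'
    let root : ℝ≥0ˣ →* ℝ≥0ˣ := Units.map (NNReal.rpowMonoidHom ((N : ℝ)⁻¹))
    refine ⟨root (glAbsDet n K g), ?_⟩
    rw [glAbsDet_posRealScalar, ← hN]
    refine Units.ext ?_
    rw [Units.val_pow_eq_pow_val]
    exact NNReal.rpow_inv_natCast_pow _ hN0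

/-- For every `g` there is a positive real scalar `z(r)` with `|det (g z(r))|_𝔸 = 1`. [folklore] -/
theorem exists_glAbsDet_mul_posRealScalar_eq_one (g : GL (Fin n) 𝔸) :
    ∃ r : ℝ≥0ˣ, glAbsDet n K (g * posRealScalar n K r) = 1 := by
  obtain ⟨r, hr⟩ := exists_glAbsDet_posRealScalar_eq n K g⁻¹
  exact ⟨r, by rw [map_mul, hr, ← map_mul, mul_inv_cancel, map_one]⟩

/-- **The norm band** `D = {g ∈ GL_n(𝔸_K) : 1/2 ≤ |det g|_𝔸 ≤ 2}`: a closed neighbourhood of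
`GL_n(𝔸_K)¹ = {|det| = 1}`, right invariant under `GL_n(K)`; it replaces the passage to `G(𝔸)¹` in
the construction of the automorphic measure. [folklore] -/
def normBand : Set (GL (Fin n) 𝔸) :=
  (fun g => ((glAbsDet n K g : ℝ≥0) : ℝ)) ⁻¹' Set.Icc (1 / 2) 2

variable {n K} in
/-- Membership in the norm band (definitional unfolding). [folklore] -/
theorem mem_normBand_iff {g : GL (Fin n) 𝔸} :
    g ∈ normBand n K ↔
      (1 / 2 : ℝ) ≤ ((glAbsDet n K g : ℝ≥0) : ℝ) ∧ ((glAbsDet n K g : ℝ≥0) : ℝ) ≤ 2 :=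
  Iff.rfl

/-- The norm band is closed. [folklore] -/
theorem isClosed_normBand : IsClosed (normBand n K) :=
  isClosed_Icc.preimage (continuous_glAbsDet_real n K)

variable {n K} in
/-- The norm band is right invariant under `GL_n(K)`. [folklore] -/
theorem mul_mem_normBand_iff {g γ : GL (Fin n) 𝔸} (hγ : γ ∈ rationalPointsGL n K) :
    g * γ ∈ normBand n K ↔ g ∈ normBand n K := by
  rw [mem_normBand_iff, mem_normBand_iff, map_mul, glAbsDet_eq_one_of_mem_rationalPointsGL hγ,
    mul_one]

variable {n K} in
/-- Left translation of the norm band by `g` is left translation by any element of the same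
absolute determinant. [folklore] -/
theorem smul_normBand_eq {g z : GL (Fin n) 𝔸} (h : glAbsDet n K z = glAbsDet n K g) :
    g • normBand n K = z • normBand n K := by
  ext x
  rw [Set.mem_smul_set_iff_inv_smul_mem, Set.mem_smul_set_iff_inv_smul_mem, smul_eq_mul,
    smul_eq_mul, mem_normBand_iff, mem_normBand_iff, map_mul, map_mul, map_inv, map_inv, h]

/-- `s ↦ z(e^s)` is continuous `ℝ → GL_n(𝔸_K)`. [folklore] -/
theorem continuous_posRealScalar_expUnitNNReal :
    Continuous fun s : ℝ => posRealScalar n K (expUnitNNReal s) := by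
  have h := (continuous_posRealDiagonal_expUnitNNReal n K).comp
    (continuous_pi fun _ : Fin n => continuous_id (X := ℝ))
  refine h.congr fun s => ?_
  exact (posRealScalar_eq_posRealDiagonal_const n K (expUnitNNReal s)).symm

end Norm

/-! ### Covering the norm band by rational translates of an inverted thick Siegel set -/

section Cover

variable (n : ℕ) (K : Type) [Field K] [NumberField K]

local notation "𝔸" => AdeleRing (𝓞 K) K

/-- **The norm band is covered by the `GL_n(K)`-translates of an inverted, centrally thickened
Siegel set.** By reduction theory (`reductionTheory_gl_holds`: `GL_n(K) · A_G · S = GL_n(𝔸_K)` for a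
Siegel set `S = Ω A_{T₀}(t) K`) there are `t > 0`, a compact `Ω ⊆ B(𝔸_K)` and a compact `Z ⊆ A_G`
with `D ⊆ ⋃_{γ ∈ GL_n(K)} (Z · Ω · A_{T₀}(t) · K)⁻¹ γ`: for `x ∈ D` write `x⁻¹ = γ z s`; then
`x γ = (z s)⁻¹` and `|det (z s)|⁻¹ = |det x| ∈ [1/2, 2]`, while `|det s|` is bounded above and below
on the thickened Siegel set (`|det| = 1` on the cone, `Ω̄` and `K` compact), which confines `z`
to a compact part of `A_G`. [folklore] -/
theorem normBand_subset_iUnion_smul :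
    ∃ (Ω : Set (GL (Fin n) 𝔸)) (t : ℝ) (Z : Set (GL (Fin n) 𝔸)), 0 < t ∧ IsCompact Ω ∧
      Ω ⊆ (standardParabolicGL (AdeleRing (𝓞 K) K) (id : Fin n → Fin n) : Set (GL (Fin n) 𝔸)) ∧
      IsCompact Z ∧ Z ⊆ Set.range (posRealScalar n K) ∧
      normBand n K ⊆ ⋃ γ : ↥(rationalPointsGL n K).op,
        γ • (Z * (Ω * siegelCone n K t *
          (standardMaximalCompactGL n K : Set (GL (Fin n) 𝔸))))⁻¹ := by
  haveI : T2Space (GL (Fin n) 𝔸) := t2Space_gl n K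
  haveI : T2Space 𝔸 := t2Space_adeleRing K
  obtain ⟨S, hS, hcov⟩ := reductionTheory_gl_holds n K
  obtain ⟨Ω, t, ht, hΩB, hΩc, rfl⟩ := hS.exists_eq
  have hKc : IsCompact (standardMaximalCompactGL n K : Set (GL (Fin n) 𝔸)) :=
    isCompact_standardMaximalCompactGL n K
  set f : GL (Fin n) 𝔸 → ℝ := fun g => ((glAbsDet n K g : ℝ≥0) : ℝ) with hf
  have hfc : Continuous f := continuous_glAbsDet_real n K
  have hfpos : ∀ g, 0 < f g := fun g =>
    NNReal.coe_pos.2 (pos_iff_ne_zero.2 (glAbsDet n K g).ne_zero)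
  have hfmul : ∀ g h, f (g * h) = f g * f h := fun g h => by
    change (((glAbsDet n K (g * h) : ℝ≥0ˣ) : ℝ≥0) : ℝ) = _
    rw [map_mul, Units.val_mul, NNReal.coe_mul]
  have hfinv : ∀ g, f g⁻¹ = (f g)⁻¹ := fun g => by
    change (((glAbsDet n K g⁻¹ : ℝ≥0ˣ) : ℝ≥0) : ℝ) = _
    rw [map_inv, Units.val_inv_eq_inv_val, NNReal.coe_inv]
  -- positive bounds of `f` on a compact set
  have hbd : ∀ C : Set (GL (Fin n) 𝔸), IsCompact C →
      ∃ lo, 0 < lo ∧ ∃ hi, ∀ c ∈ C, lo ≤ f c ∧ f c ≤ hi := by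
    intro C hC
    rcases C.eq_empty_or_nonempty with h | hne
    · exact ⟨1, one_pos, 1, fun c hc => by rw [h] at hc; exact absurd hc (Set.notMem_empty c)⟩
    · obtain ⟨c₀, -, hmin⟩ := hC.exists_isMinOn hne hfc.continuousOn
      obtain ⟨c₁, -, hmax⟩ := hC.exists_isMaxOn hne hfc.continuousOn
      exact ⟨f c₀, hfpos c₀, f c₁, fun c hc => ⟨hmin hc, hmax hc⟩⟩
  obtain ⟨lo₁, hlo₁, hi₁, hΩbd⟩ := hbd (closure Ω) hΩc
  obtain ⟨lo₂, hlo₂, hi₂, hKbd⟩ := hbd _ hKc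
  have hhi₁ : 0 < hi₁ := by
    rcases (closure Ω).eq_empty_or_nonempty with h | ⟨ω, hω⟩
    · have : (1 : GL (Fin n) 𝔸) ∈ (Set.univ : Set (GL (Fin n) 𝔸)) := Set.mem_univ _
      rw [← hcov] at this
      obtain ⟨_, _, s, ⟨_, ⟨ω, hω, _, _, rfl⟩, _, _, rfl⟩, _⟩ := this
      exact absurd (subset_closure hω) (by rw [h]; exact Set.notMem_empty ω)
    · exact (hfpos ω).trans_le (hΩbd ω hω).2
  have hhi₂ : 0 < hi₂ := (hfpos 1).trans_le (hKbd 1 (Subgroup.one_mem _)).2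
  -- the compact set of central elements, in logarithmic coordinates
  set N : ℕ := n * Module.finrank ℚ K with hN
  set A : ℝ := Real.log (1 / (2 * (hi₁ * hi₂))) / N with hA
  set B : ℝ := Real.log (2 / (lo₁ * lo₂)) / N with hB
  set Z : Set (GL (Fin n) 𝔸) := (fun s : ℝ => posRealScalar n K (expUnitNNReal s)) '' Set.Icc A B
    with hZ
  refine ⟨closure Ω, t, Z, ht, hΩc,
    closure_minimal hΩB (standardParabolicGL_isClosed (id : Fin n → Fin n)),
    isCompact_Icc.image (continuous_posRealScalar_expUnitNNReal n K), ?_, ?_⟩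
  · rintro _ ⟨s, _, rfl⟩; exact ⟨_, rfl⟩
  -- the covering
  intro x hx
  have hx' : x⁻¹ ∈ (Set.univ : Set (GL (Fin n) 𝔸)) := Set.mem_univ _
  rw [← hcov] at hx'
  obtain ⟨_, ⟨γ, hγ, _, ⟨r, rfl⟩, rfl⟩, s, hs, hxinv⟩ := hx'
  obtain ⟨_, ⟨ω, hω, a, ha, rfl⟩, k, hk, rfl⟩ := hs
  -- `f (z(r))` is confined
  have hfz : f (posRealScalar n K r) = ((r : ℝ≥0) : ℝ) ^ N := by
    change (((glAbsDet n K (posRealScalar n K r) : ℝ≥0ˣ) : ℝ≥0) : ℝ) = _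
    rw [glAbsDet_posRealScalar, Units.val_pow_eq_pow_val, NNReal.coe_pow]
  have hfa : f a = 1 := by
    change (((glAbsDet n K a : ℝ≥0ˣ) : ℝ≥0) : ℝ) = 1
    rw [glAbsDet_eq_one_of_mem_siegelCone ha, Units.val_one, NNReal.coe_one]
  have hfs : lo₁ * lo₂ ≤ f (ω * a * k) ∧ f (ω * a * k) ≤ hi₁ * hi₂ := by
    rw [hfmul, hfmul, hfa, mul_one]
    obtain ⟨h1, h2⟩ := hΩbd ω (subset_closure hω)
    obtain ⟨h3, h4⟩ := hKbd k hk
    exact ⟨mul_le_mul h1 h3 hlo₂.le ((hlo₁.le).trans h1),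
      mul_le_mul h2 h4 (hfpos k).le ((hfpos ω).le.trans h2)⟩
  have hxinv' : γ * posRealScalar n K r * (ω * a * k) = x⁻¹ := hxinv
  have hfx : f x = (f (posRealScalar n K r) * f (ω * a * k))⁻¹ := by
    have : x = (γ * posRealScalar n K r * (ω * a * k))⁻¹ := by rw [hxinv', inv_inv]
    rw [this, hfinv, hfmul, hfmul]
    change ((((glAbsDet n K γ : ℝ≥0ˣ) : ℝ≥0) : ℝ) * _ * _)⁻¹ = _
    rw [glAbsDet_eq_one_of_mem_rationalPointsGL hγ, Units.val_one, NNReal.coe_one, one_mul]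
  obtain ⟨hx1, hx2⟩ := mem_normBand_iff.1 hx
  change (1 / 2 : ℝ) ≤ f x at hx1
  change f x ≤ 2 at hx2
  have hu : 0 < f (posRealScalar n K r) := hfpos _
  have hv : 0 < f (ω * a * k) := hfpos _
  have huv_lo : 1 ≤ 2 * (f (posRealScalar n K r) * f (ω * a * k)) := by
    rw [hfx, ← one_div, div_le_iff₀ (mul_pos hu hv)] at hx2
    linarith
  have huv_hi : f (posRealScalar n K r) * f (ω * a * k) ≤ 2 := by
    rw [hfx, ← one_div, le_div_iff₀ (mul_pos hu hv)] at hx1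
    linarith
  have hzlo : 1 / (2 * (hi₁ * hi₂)) ≤ f (posRealScalar n K r) := by
    rw [div_le_iff₀ (mul_pos two_pos (mul_pos hhi₁ hhi₂))]
    nlinarith [mul_le_mul_of_nonneg_left hfs.2 hu.le]
  have hzhi : f (posRealScalar n K r) ≤ 2 / (lo₁ * lo₂) := by
    rw [le_div_iff₀ (mul_pos hlo₁ hlo₂)]
    nlinarith [mul_le_mul_of_nonneg_left hfs.1 hu.le]
  -- hence `z(r) ∈ Z`
  have hzZ : posRealScalar n K r ∈ Z := by
    rcases Nat.eq_zero_or_pos n with hn | hn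
    · subst hn
      refine ⟨A, ⟨le_rfl, ?_⟩, Subsingleton.elim _ _⟩
      rw [hA, hB, hN, zero_mul, Nat.cast_zero, div_zero, div_zero]
    · have hN0 : N ≠ 0 := Nat.mul_ne_zero hn.ne' Module.finrank_pos.ne'
      have hNpos : (0 : ℝ) < N := Nat.cast_pos.2 (Nat.pos_of_ne_zero hN0)
      have hrpos : (0 : ℝ) < ((r : ℝ≥0) : ℝ) := NNReal.coe_pos.2 (pos_iff_ne_zero.2 r.ne_zero)
      refine ⟨Real.log ((r : ℝ≥0) : ℝ), ⟨?_, ?_⟩, ?_⟩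
      · rw [hA, div_le_iff₀ hNpos, mul_comm (Real.log _) (N : ℝ), ← Real.log_pow, ← hfz]
        exact Real.log_le_log (by positivity) hzlo
      · rw [hB, le_div_iff₀ hNpos, mul_comm (Real.log _) (N : ℝ), ← Real.log_pow, ← hfz]
        exact Real.log_le_log hu hzhi
      · change posRealScalar n K (expUnitNNReal (Real.log ((r : ℝ≥0) : ℝ))) = posRealScalar n K r
        rw [expUnitNNReal_log]
  -- and `x = (z s)⁻¹ · γ⁻¹`
  refine Set.mem_iUnion.2 ⟨⟨MulOpposite.op γ⁻¹, Subgroup.mem_op.2 (Subgroup.inv_mem _ hγ)⟩, ?_⟩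
  rw [Set.mem_smul_set_iff_inv_smul_mem]
  refine Set.mem_inv.2 ?_
  change (x * (γ⁻¹)⁻¹)⁻¹ ∈ Z * (closure Ω * siegelCone n K t *
    (standardMaximalCompactGL n K : Set (GL (Fin n) 𝔸)))
  rw [inv_inv, _root_.mul_inv_rev, ← hxinv',
    ← mul_assoc γ⁻¹ (γ * posRealScalar n K r) (ω * a * k), inv_mul_cancel_left]
  exact ⟨_, hzZ, _, ⟨_, ⟨ω, subset_closure hω, a, ha, rfl⟩, k, hk, rfl⟩, rfl⟩

end Cover

end Literature.NumberTheory.Automorphic
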